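import Summits.Ventures.LatticeQCDFlow.Exactness.IMHColdStartAutocovBias
import Summits.Ventures.LatticeQCDFlow.Exactness.IMHColdStartErrorBar
import HarnessLib

/-!
# The sample variance of an exact sampler's run, exactly: at equilibrium it underestimates `Var_π f` by the
# mean-square error of the mean; from the cold start it is biased at first order like a plain observable

HONEST FRAMING: exact (Metropolis-corrected) sampling algorithms for lattice gauge theory;
figures of merit are autocorrelation/cost numbers at stated couplings and volumes; no
continuum-physics claim.

Venture `LatticeQCDFlow` (cell pub-lqcd), topic `Exactness`; FANOUT row 30 (lean-1, GEN-33).  NEW WORK of the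
cell, general state space.  GEN-32 computed cold-started second moments with the TRUE mean subtracted
(`IMHColdStartAutocovBias`: "NOT CLAIMED: estimators centred at the empirical mean").  The statistic a seat prints
is the SAMPLE VARIANCE `v̂_N = (1/N)Σ_{i<N}(f(X_i) − m_N)²`, `m_N = (1/N)Σ_{i<N} f(X_i)` — empirically centred.  With
`MSE_μ(N) = E_μ[(m_N − π f)²]`, `V = Var_π f`, `δ = f(x₀) − π f`, `S_N = Σ_{t<N} r^t`, `w = w(x₀) = 1/A`:

* §1 **`sampleVariance_eq_centred_sub_sq`** — pathwise: `v̂_N = (1/N)Σ(f(X_i) − m)² − (m_N − m)²` for every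
  constant `m` (so for `m = π f`).
* §2 any Markov kernel started in an invariant law: **`chain_sampleVariance_stationary_eq`** —
  `E_π[v̂_N] = Var_π f − MSE_π(N)` EXACTLY: AT EQUILIBRIUM THE SAMPLE VARIANCE UNDERESTIMATES THE VARIANCE BY EXACTLY
  THE MEAN-SQUARE ERROR OF THE MEAN (for independent draws this is the Bessel `V/N`; for a chain it is
  `σ²_f/N`-sized).
* §3 flow-MCMC `indepMH q w` at equilibrium (all autocovariances `≥ 0`, `Scoring/IndepMHKernelPositive`):
  **`imh_chain_mse_stationary_ge`** `MSE_π(N) ≥ V/N`, hence **`imh_chain_sampleVariance_stationary_two_sided`**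
  `V·(1 − (2w − 1)/N) ≤ E_π[v̂_N] ≤ V·(1 − 1/N)` — THE BESSEL CORRECTION `N/(N−1)` IS NEVER ENOUGH FOR AN EXACT
  SAMPLER, and (**`imh_chain_naiveErrorBar_stationary_le`**) THE NAIVE (i.i.d.) ERROR BAR IS OPTIMISTIC IN
  EXPECTATION AT EVERY `N ≥ 2`: `E_π[v̂_N]/(N − 1) ≤ V/N ≤ MSE_π(N)`.
* §4 from the mode `x₀`: **`imh_chain_sampleVariance_mode_eq`** — `E_{x₀}[v̂_N] = V + (δ² − V)·S_N/N − MSE_{x₀}(N)`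
  EXACTLY; against equilibrium **`imh_chain_sampleVariance_mode_sub_stationary`**
  `E_{x₀}[v̂_N] − E_π[v̂_N] = (δ² − V)·S_N/N − (MSE_{x₀}(N) − MSE_π(N))`: the sample variance carries the FIRST-ORDER
  cold-start bias of the observable `(f − π f)²` (cold offset `δ² − V`, GEN-31's `S_N/N ≈ 1/(N·A)` law) minus
  GEN-32's second-order correction, so (**`imh_chain_sampleVariance_mode_two_sided`**)
  `(δ² − V)S_N/N − (2w² − w)δ²/N² ≤ E_{x₀}[v̂_N] − E_π[v̂_N] ≤ (δ² − V)S_N/N + (2w² − w)V/N²` — an observable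
  extremal at the cold configuration (`V ≤ δ²`, the plaquette) prints TOO LARGE a variance from a cold start, one
  with `f(x₀) = π f` too small.

NOT CLAIMED: the variance of `v̂_N`; the windowed/lagged empirical autocovariances (their exact cold-start laws
follow the same way from `IMHColdStartTwoTime` but are not written here); any number for a specific weight.

No `sorry`, no new definitions, nothing cited as a fact; general measurable space with measurable singletons.
-/

noncomputable section

namespace Summit.Ventures.LatticeQCDFlow.Exactness

open MeasureTheory ProbabilityTheory Function Finset
open scoped ENNReal
open Summit.Ventures.LatticeQCDFlow.Scoring

variable {Ω : Type*} [MeasurableSpace Ω]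

/-! ## §1 Pathwise: empirical centring = true centring minus the squared error of the mean -/

/-- **`(1/N)Σ_{i<N}(a_i − ā)² = (1/N)Σ_{i<N}(a_i − m)² − (ā − m)²`**, `ā = (1/N)Σ a_i`, for every constant `m` and
`N ≠ 0`. [ours, algebra] -/
theorem sampleVariance_eq_centred_sub_sq (a : ℕ → ℝ) (m : ℝ) {N : ℕ} (hN : N ≠ 0) :
    (∑ i ∈ Finset.range N, (a i - (∑ j ∈ Finset.range N, a j) / N) ^ 2) / N =
      (∑ i ∈ Finset.range N, (a i - m) ^ 2) / N - ((∑ j ∈ Finset.range N, a j) / N - m) ^ 2 := by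
  have hN' : (N : ℝ) ≠ 0 := by exact_mod_cast hN
  have key : ∀ c : ℝ, ∑ i ∈ Finset.range N, (a i - c) ^ 2 =
      ∑ i ∈ Finset.range N, (a i - m) ^ 2 - 2 * (c - m) * ∑ i ∈ Finset.range N, (a i - m) + N * (c - m) ^ 2 := by
    intro c
    rw [Finset.mul_sum, ← Finset.sum_sub_distrib]
    rw [show (N : ℝ) * (c - m) ^ 2 = ∑ i ∈ Finset.range N, (c - m) ^ 2 by
      rw [Finset.sum_const, Finset.card_range, nsmul_eq_mul], ← Finset.sum_add_distrib]
    refine Finset.sum_congr rfl fun i _ => ?_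
    ring
  have hsum : ∑ i ∈ Finset.range N, (a i - m) = N * ((∑ j ∈ Finset.range N, a j) / N - m) := by
    rw [Finset.sum_sub_distrib, Finset.sum_const, Finset.card_range, nsmul_eq_mul]
    field_simp
  rw [key, hsum]
  field_simp
  ring

/-! ## §2 Any Markov kernel at equilibrium: `E_π[v̂_N] = Var_π f − MSE_π(N)` -/

section Stationary

variable (κ : Kernel Ω Ω) [IsMarkovKernel κ]

/-- **AT EQUILIBRIUM THE SAMPLE VARIANCE UNDERESTIMATES `Var_π f` BY EXACTLY THE MEAN-SQUARE ERROR OF THE MEAN**: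
for every Markov kernel `κ` with invariant probability law `π`, every bounded measurable `f` and `N ≠ 0`,
`E_π[(1/N)Σ_{i<N}(f(X_i) − m_N)²] = ∫ (f − π f)² dπ − E_π[(m_N − π f)²]`. [ours] -/
theorem chain_sampleVariance_stationary_eq {π : Measure Ω} [IsProbabilityMeasure π] (hπ : Kernel.Invariant κ π)
    {f : Ω → ℝ} (hf : Measurable f) {C : ℝ} (hC : ∀ x, |f x| ≤ C) {N : ℕ} (hN : N ≠ 0) :
    ∫ x, (∑ i ∈ Finset.range N, (f (x i) - (∑ j ∈ Finset.range N, f (x j)) / N) ^ 2) / N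
        ∂(Kernel.trajMeasure (X := fun _ : ℕ => Ω) π
          (fun n : ℕ => κ.comap (fun h : (i : ↥(Finset.Iic n)) → Ω => h ⟨n, Finset.mem_Iic.2 le_rfl⟩)
            (measurable_pi_apply _))) =
      ∫ x, (f x - ∫ z, f z ∂π) ^ 2 ∂π -
        ∫ x, ((∑ i ∈ Finset.range N, f (x i)) / N - ∫ z, f z ∂π) ^ 2
          ∂(Kernel.trajMeasure (X := fun _ : ℕ => Ω) π
            (fun n : ℕ => κ.comap (fun h : (i : ↥(Finset.Iic n)) → Ω => h ⟨n, Finset.mem_Iic.2 le_rfl⟩)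
              (measurable_pi_apply _))) := by
  set P := Kernel.trajMeasure (X := fun _ : ℕ => Ω) π
      (fun n : ℕ => κ.comap (fun h : (i : ↥(Finset.Iic n)) → Ω => h ⟨n, Finset.mem_Iic.2 le_rfl⟩)
        (measurable_pi_apply _)) with hP
  set m := ∫ z, f z ∂π with hm
  have hgm : Measurable fun z => (f z - m) ^ 2 := (hf.sub measurable_const).pow_const 2
  have hgb : ∀ z, |(f z - m) ^ 2| ≤ (C + |m|) ^ 2 := fun z => by
    rw [abs_pow]
    exact pow_le_pow_left₀ (abs_nonneg _) ((abs_sub _ _).trans (add_le_add (hC z) le_rfl)) 2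
  -- pathwise identity, then linearity
  have hpt : ∀ x : ℕ → Ω, (∑ i ∈ Finset.range N, (f (x i) - (∑ j ∈ Finset.range N, f (x j)) / N) ^ 2) / N =
      (∑ i ∈ Finset.range N, (f (x i) - m) ^ 2) / N - ((∑ j ∈ Finset.range N, f (x j)) / N - m) ^ 2 :=
    fun x => sampleVariance_eq_centred_sub_sq (fun i => f (x i)) m hN
  simp_rw [hpt]
  have hint1 : Integrable (fun x : ℕ → Ω => (∑ i ∈ Finset.range N, (f (x i) - m) ^ 2) / N) P := by
    refine Integrable.div_const (integrable_finsetSum _ fun i _ => ?_) _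
    exact integrable_of_bounded P (hgm.comp (measurable_pi_apply i)) fun x => hgb (x i)
  have hint2 : Integrable (fun x : ℕ → Ω => ((∑ j ∈ Finset.range N, f (x j)) / N - m) ^ 2) P := by
    have hA : Measurable fun x : ℕ → Ω => ((∑ j ∈ Finset.range N, f (x j)) / N - m) ^ 2 :=
      (((Finset.measurable_sum _ fun j _ => hf.comp (measurable_pi_apply j)).div_const _).sub
        measurable_const).pow_const 2
    refine integrable_of_bounded P hA (C := (C + |m|) ^ 2) fun x => ?_
    rw [abs_pow]
    refine pow_le_pow_left₀ (abs_nonneg _) ((abs_sub _ _).trans (add_le_add ?_ le_rfl)) 2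
    exact abs_timeAverage_le hC hN x
  rw [integral_sub hint1 hint2]
  congr 1
  -- the true-centred average has expectation `Var_π f` by stationarity of every marginal
  have hsumint : ∫ x, ∑ i ∈ Finset.range N, (f (x i) - m) ^ 2 ∂P = ∑ i ∈ Finset.range N, ∫ x, (f (x i) - m) ^ 2 ∂P :=
    integral_finsetSum _ fun i _ => integrable_of_bounded P (hgm.comp (measurable_pi_apply i)) fun x => hgb (x i)
  rw [show (fun x : ℕ → Ω => (∑ i ∈ Finset.range N, (f (x i) - m) ^ 2) / N) =
      fun x => (N : ℝ)⁻¹ * ∑ i ∈ Finset.range N, (f (x i) - m) ^ 2 by funext x; rw [div_eq_inv_mul],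
    integral_const_mul, hsumint]
  have hmarg : ∀ i, ∫ x, (f (x i) - m) ^ 2 ∂P = ∫ z, (f z - m) ^ 2 ∂π := fun i => by
    rw [hP]; exact chain_marginal hπ i (f := fun z => (f z - m) ^ 2) hgm hgb
  simp_rw [hmarg]
  rw [Finset.sum_const, Finset.card_range, nsmul_eq_mul, ← mul_assoc,
    inv_mul_cancel₀ (by exact_mod_cast hN : (N : ℝ) ≠ 0), one_mul]

end Stationary

/-! ## §3 Flow-MCMC at equilibrium: `MSE_π(N) ≥ V/N`, the Bessel correction is never enough -/

variable [MeasurableSingletonClass Ω] {q : Measure Ω} [IsProbabilityMeasure q] {w : Ω → ℝ}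

omit [MeasurableSingletonClass Ω] in
/-- **`MSE_π(N) ≥ Var_π f / N` for flow-MCMC** (all autocovariances of an independence sampler are nonnegative).
[ours] -/
theorem imh_chain_mse_stationary_ge [Fact (Measurable w)] (hw0 : ∀ y, 0 < w y) {x₀ : Ω} (hmax : ∀ y, w y ≤ w x₀)
    [IsProbabilityMeasure (q.withDensity fun y => ENNReal.ofReal (w y))]
    {f : Ω → ℝ} (hf : Measurable f) {C : ℝ} (hC : ∀ x, |f x| ≤ C) {N : ℕ} (hN : N ≠ 0) :
    (∫ x, (f x - ∫ z, f z ∂(q.withDensity fun y => ENNReal.ofReal (w y))) ^ 2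
        ∂(q.withDensity fun y => ENNReal.ofReal (w y))) / N ≤
      ∫ x, ((∑ i ∈ Finset.range N, f (x i)) / N - ∫ z, f z ∂(q.withDensity fun y => ENNReal.ofReal (w y))) ^ 2
        ∂(Kernel.trajMeasure (X := fun _ : ℕ => Ω) (q.withDensity fun y => ENNReal.ofReal (w y))
          (fun n : ℕ => (indepMH q w).comap (fun h : (i : ↥(Finset.Iic n)) → Ω => h ⟨n, Finset.mem_Iic.2 le_rfl⟩)
            (measurable_pi_apply _))) := by
  set π : Measure Ω := q.withDensity fun y => ENNReal.ofReal (w y) with hπdef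
  have hw : Measurable w := Fact.out
  have hπK : Kernel.Invariant (indepMH q w) π := indepMH_invariant (q := q) hw hw0
  have hNpos : (0 : ℝ) < N := by exact_mod_cast Nat.pos_of_ne_zero hN
  rw [chain_mse_stationary_eq (indepMH q w) hπK hf hC hN]
  -- keep only the diagonal of the double sum of nonnegative autocovariances
  have hγ0 : ∀ u, 0 ≤ autocov (indepMH q w) π (fun x => f x - ∫ z, f z ∂π) u := fun u =>
    (imh_autocov_centred_bounds (q := q) hw hw0 hmax hf hC u).1
  have hdiag : ∀ i ∈ Finset.range N, autocov (indepMH q w) π (fun x => f x - ∫ z, f z ∂π) 0 ≤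
      ∑ j ∈ Finset.range N, autocov (indepMH q w) π (fun x => f x - ∫ z, f z ∂π) (Nat.dist i j) := by
    intro i hi
    rw [← Finset.add_sum_erase _ _ hi, Nat.dist_self]
    exact le_add_of_nonneg_right (Finset.sum_nonneg fun j _ => hγ0 _)
  have hV : autocov (indepMH q w) π (fun x => f x - ∫ z, f z ∂π) 0 = ∫ x, (f x - ∫ z, f z ∂π) ^ 2 ∂π := by
    unfold autocov
    simp only [Function.iterate_zero, id, pow_two]
  calc (∫ x, (f x - ∫ z, f z ∂π) ^ 2 ∂π) / N = (N * ∫ x, (f x - ∫ z, f z ∂π) ^ 2 ∂π) / (N : ℝ) ^ 2 := by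
        field_simp
    _ ≤ _ := by
        refine div_le_div_of_nonneg_right ?_ (by positivity)
        rw [← hV, show (N : ℝ) * autocov (indepMH q w) π (fun x => f x - ∫ z, f z ∂π) 0 =
          ∑ i ∈ Finset.range N, autocov (indepMH q w) π (fun x => f x - ∫ z, f z ∂π) 0 by
            rw [Finset.sum_const, Finset.card_range, nsmul_eq_mul]]
        exact Finset.sum_le_sum hdiag

omit [MeasurableSingletonClass Ω] in
/-- **`V·(1 − (2w − 1)/N) ≤ E_π[v̂_N] ≤ V·(1 − 1/N)` for flow-MCMC at equilibrium**: the Bessel correction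
`N/(N − 1)` never suffices to unbias the sample variance of an exact sampler's run. [ours] -/
theorem imh_chain_sampleVariance_stationary_two_sided [Fact (Measurable w)] (hw0 : ∀ y, 0 < w y) {x₀ : Ω}
    (hmax : ∀ y, w y ≤ w x₀) [IsProbabilityMeasure (q.withDensity fun y => ENNReal.ofReal (w y))]
    {f : Ω → ℝ} (hf : Measurable f) {C : ℝ} (hC : ∀ x, |f x| ≤ C) {N : ℕ} (hN : N ≠ 0) :
    (∫ x, (f x - ∫ z, f z ∂(q.withDensity fun y => ENNReal.ofReal (w y))) ^ 2
        ∂(q.withDensity fun y => ENNReal.ofReal (w y))) * (1 - (2 * w x₀ - 1) / N) ≤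
      ∫ x, (∑ i ∈ Finset.range N, (f (x i) - (∑ j ∈ Finset.range N, f (x j)) / N) ^ 2) / N
        ∂(Kernel.trajMeasure (X := fun _ : ℕ => Ω) (q.withDensity fun y => ENNReal.ofReal (w y))
          (fun n : ℕ => (indepMH q w).comap (fun h : (i : ↥(Finset.Iic n)) → Ω => h ⟨n, Finset.mem_Iic.2 le_rfl⟩)
            (measurable_pi_apply _))) ∧
    ∫ x, (∑ i ∈ Finset.range N, (f (x i) - (∑ j ∈ Finset.range N, f (x j)) / N) ^ 2) / N
        ∂(Kernel.trajMeasure (X := fun _ : ℕ => Ω) (q.withDensity fun y => ENNReal.ofReal (w y))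
          (fun n : ℕ => (indepMH q w).comap (fun h : (i : ↥(Finset.Iic n)) → Ω => h ⟨n, Finset.mem_Iic.2 le_rfl⟩)
            (measurable_pi_apply _))) ≤
      (∫ x, (f x - ∫ z, f z ∂(q.withDensity fun y => ENNReal.ofReal (w y))) ^ 2
        ∂(q.withDensity fun y => ENNReal.ofReal (w y))) * (1 - 1 / N) := by
  have hw : Measurable w := Fact.out
  have hπK : Kernel.Invariant (indepMH q w) (q.withDensity fun y => ENNReal.ofReal (w y)) :=
    indepMH_invariant (q := q) hw hw0
  rw [chain_sampleVariance_stationary_eq (indepMH q w) hπK hf hC hN]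
  have hlo := imh_chain_mse_stationary_ge (q := q) hw0 hmax hf hC hN
  have hhi := imh_chain_mse_stationary_le (q := q) hw0 hmax hf hC hN
  constructor
  · rw [mul_sub, mul_one, mul_div_assoc', mul_comm]
    linarith
  · rw [mul_sub, mul_one, mul_one_div]
    linarith

omit [MeasurableSingletonClass Ω] in
/-- **THE NAIVE ERROR BAR IS OPTIMISTIC**: for `N ≥ 2`, `E_π[v̂_N]/(N − 1) ≤ Var_π f/N ≤ MSE_π(N)` — the i.i.d.
recipe applied to an exact sampler's equilibrium run under-reports the mean-square error of the mean, in
expectation, at every run length. [ours] -/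
theorem imh_chain_naiveErrorBar_stationary_le [Fact (Measurable w)] (hw0 : ∀ y, 0 < w y) {x₀ : Ω}
    (hmax : ∀ y, w y ≤ w x₀) [IsProbabilityMeasure (q.withDensity fun y => ENNReal.ofReal (w y))]
    {f : Ω → ℝ} (hf : Measurable f) {C : ℝ} (hC : ∀ x, |f x| ≤ C) {N : ℕ} (hN : 2 ≤ N) :
    (∫ x, (∑ i ∈ Finset.range N, (f (x i) - (∑ j ∈ Finset.range N, f (x j)) / N) ^ 2) / N
        ∂(Kernel.trajMeasure (X := fun _ : ℕ => Ω) (q.withDensity fun y => ENNReal.ofReal (w y))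
          (fun n : ℕ => (indepMH q w).comap (fun h : (i : ↥(Finset.Iic n)) → Ω => h ⟨n, Finset.mem_Iic.2 le_rfl⟩)
            (measurable_pi_apply _)))) / (N - 1) ≤
      (∫ x, (f x - ∫ z, f z ∂(q.withDensity fun y => ENNReal.ofReal (w y))) ^ 2
        ∂(q.withDensity fun y => ENNReal.ofReal (w y))) / N ∧
    (∫ x, (f x - ∫ z, f z ∂(q.withDensity fun y => ENNReal.ofReal (w y))) ^ 2
        ∂(q.withDensity fun y => ENNReal.ofReal (w y))) / N ≤
      ∫ x, ((∑ i ∈ Finset.range N, f (x i)) / N - ∫ z, f z ∂(q.withDensity fun y => ENNReal.ofReal (w y))) ^ 2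
        ∂(Kernel.trajMeasure (X := fun _ : ℕ => Ω) (q.withDensity fun y => ENNReal.ofReal (w y))
          (fun n : ℕ => (indepMH q w).comap (fun h : (i : ↥(Finset.Iic n)) → Ω => h ⟨n, Finset.mem_Iic.2 le_rfl⟩)
            (measurable_pi_apply _))) := by
  have hN0 : N ≠ 0 := by omega
  have hN1 : (0 : ℝ) < N - 1 := by
    have : (2 : ℝ) ≤ N := by exact_mod_cast hN
    linarith
  have hNpos : (0 : ℝ) < N := by exact_mod_cast Nat.pos_of_ne_zero hN0
  refine ⟨?_, imh_chain_mse_stationary_ge (q := q) hw0 hmax hf hC hN0⟩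
  have h2 := (imh_chain_sampleVariance_stationary_two_sided (q := q) hw0 hmax hf hC hN0).2
  rw [div_le_iff₀ hN1]
  refine h2.trans (le_of_eq ?_)
  field_simp

/-! ## §4 From the mode: the sample variance is biased at first order -/

/-- **THE COLD-STARTED SAMPLE VARIANCE, EXACTLY**: `E_{x₀}[v̂_N] = V + (δ² − V)·S_N/N − MSE_{x₀}(N)`. [ours] -/
theorem imh_chain_sampleVariance_mode_eq [Fact (Measurable w)] (hw0 : ∀ y, 0 < w y) {x₀ : Ω}
    (hmax : ∀ y, w y ≤ w x₀) [IsProbabilityMeasure (q.withDensity fun y => ENNReal.ofReal (w y))]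
    {f : Ω → ℝ} (hf : Measurable f) {C : ℝ} (hC : ∀ x, |f x| ≤ C) {N : ℕ} (hN : N ≠ 0) :
    ∫ x, (∑ i ∈ Finset.range N, (f (x i) - (∑ j ∈ Finset.range N, f (x j)) / N) ^ 2) / N
        ∂(Kernel.trajMeasure (X := fun _ : ℕ => Ω) (Measure.dirac x₀)
          (fun n : ℕ => (indepMH q w).comap (fun h : (i : ↥(Finset.Iic n)) → Ω => h ⟨n, Finset.mem_Iic.2 le_rfl⟩)
            (measurable_pi_apply _))) =
      ∫ x, (f x - ∫ z, f z ∂(q.withDensity fun y => ENNReal.ofReal (w y))) ^ 2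
          ∂(q.withDensity fun y => ENNReal.ofReal (w y)) +
        ((f x₀ - ∫ z, f z ∂(q.withDensity fun y => ENNReal.ofReal (w y))) ^ 2 -
            ∫ x, (f x - ∫ z, f z ∂(q.withDensity fun y => ENNReal.ofReal (w y))) ^ 2
              ∂(q.withDensity fun y => ENNReal.ofReal (w y))) *
          (∑ s ∈ Finset.range N, (1 - (w x₀)⁻¹) ^ s) / N -
        ∫ x, ((∑ i ∈ Finset.range N, f (x i)) / N - ∫ z, f z ∂(q.withDensity fun y => ENNReal.ofReal (w y))) ^ 2
          ∂(Kernel.trajMeasure (X := fun _ : ℕ => Ω) (Measure.dirac x₀)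
            (fun n : ℕ => (indepMH q w).comap (fun h : (i : ↥(Finset.Iic n)) → Ω => h ⟨n, Finset.mem_Iic.2 le_rfl⟩)
              (measurable_pi_apply _))) := by
  set π : Measure Ω := q.withDensity fun y => ENNReal.ofReal (w y) with hπdef
  set P := Kernel.trajMeasure (X := fun _ : ℕ => Ω) (Measure.dirac x₀)
      (fun n : ℕ => (indepMH q w).comap (fun h : (i : ↥(Finset.Iic n)) → Ω => h ⟨n, Finset.mem_Iic.2 le_rfl⟩)
        (measurable_pi_apply _)) with hP
  set m := ∫ z, f z ∂π with hm
  have hgm : Measurable fun z => (f z - m) ^ 2 := (hf.sub measurable_const).pow_const 2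
  have hgb : ∀ z, |(f z - m) ^ 2| ≤ (C + |m|) ^ 2 := fun z => by
    rw [abs_pow]
    exact pow_le_pow_left₀ (abs_nonneg _) ((abs_sub _ _).trans (add_le_add (hC z) le_rfl)) 2
  have hpt : ∀ x : ℕ → Ω, (∑ i ∈ Finset.range N, (f (x i) - (∑ j ∈ Finset.range N, f (x j)) / N) ^ 2) / N =
      (∑ i ∈ Finset.range N, (f (x i) - m) ^ 2) / N - ((∑ j ∈ Finset.range N, f (x j)) / N - m) ^ 2 :=
    fun x => sampleVariance_eq_centred_sub_sq (fun i => f (x i)) m hN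
  simp_rw [hpt]
  have hint1 : Integrable (fun x : ℕ → Ω => (∑ i ∈ Finset.range N, (f (x i) - m) ^ 2) / N) P := by
    refine Integrable.div_const (integrable_finsetSum _ fun i _ => ?_) _
    exact integrable_of_bounded P (hgm.comp (measurable_pi_apply i)) fun x => hgb (x i)
  have hint2 : Integrable (fun x : ℕ → Ω => ((∑ j ∈ Finset.range N, f (x j)) / N - m) ^ 2) P := by
    have hA : Measurable fun x : ℕ → Ω => ((∑ j ∈ Finset.range N, f (x j)) / N - m) ^ 2 :=
      (((Finset.measurable_sum _ fun j _ => hf.comp (measurable_pi_apply j)).div_const _).sub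
        measurable_const).pow_const 2
    refine integrable_of_bounded P hA (C := (C + |m|) ^ 2) fun x => ?_
    rw [abs_pow]
    refine pow_le_pow_left₀ (abs_nonneg _) ((abs_sub _ _).trans (add_le_add ?_ le_rfl)) 2
    exact abs_timeAverage_le hC hN x
  rw [integral_sub hint1 hint2]
  congr 1
  have hsumint : ∫ x, ∑ i ∈ Finset.range N, (f (x i) - m) ^ 2 ∂P = ∑ i ∈ Finset.range N, ∫ x, (f (x i) - m) ^ 2 ∂P :=
    integral_finsetSum _ fun i _ => integrable_of_bounded P (hgm.comp (measurable_pi_apply i)) fun x => hgb (x i)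
  rw [show (fun x : ℕ → Ω => (∑ i ∈ Finset.range N, (f (x i) - m) ^ 2) / N) =
      fun x => (N : ℝ)⁻¹ * ∑ i ∈ Finset.range N, (f (x i) - m) ^ 2 by funext x; rw [div_eq_inv_mul],
    integral_const_mul, hsumint, ← div_eq_inv_mul]
  rw [hP, hπdef]
  exact imh_chain_varianceEstimate_mode hw0 hmax hf hC hN

/-- **AGAINST EQUILIBRIUM**: `E_{x₀}[v̂_N] − E_π[v̂_N] = (δ² − V)·S_N/N − (MSE_{x₀}(N) − MSE_π(N))`. [ours] -/
theorem imh_chain_sampleVariance_mode_sub_stationary [Fact (Measurable w)] (hw0 : ∀ y, 0 < w y) {x₀ : Ω}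
    (hmax : ∀ y, w y ≤ w x₀) [IsProbabilityMeasure (q.withDensity fun y => ENNReal.ofReal (w y))]
    {f : Ω → ℝ} (hf : Measurable f) {C : ℝ} (hC : ∀ x, |f x| ≤ C) {N : ℕ} (hN : N ≠ 0) :
    ∫ x, (∑ i ∈ Finset.range N, (f (x i) - (∑ j ∈ Finset.range N, f (x j)) / N) ^ 2) / N
        ∂(Kernel.trajMeasure (X := fun _ : ℕ => Ω) (Measure.dirac x₀)
          (fun n : ℕ => (indepMH q w).comap (fun h : (i : ↥(Finset.Iic n)) → Ω => h ⟨n, Finset.mem_Iic.2 le_rfl⟩)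
            (measurable_pi_apply _))) -
      ∫ x, (∑ i ∈ Finset.range N, (f (x i) - (∑ j ∈ Finset.range N, f (x j)) / N) ^ 2) / N
        ∂(Kernel.trajMeasure (X := fun _ : ℕ => Ω) (q.withDensity fun y => ENNReal.ofReal (w y))
          (fun n : ℕ => (indepMH q w).comap (fun h : (i : ↥(Finset.Iic n)) → Ω => h ⟨n, Finset.mem_Iic.2 le_rfl⟩)
            (measurable_pi_apply _))) =
      ((f x₀ - ∫ z, f z ∂(q.withDensity fun y => ENNReal.ofReal (w y))) ^ 2 -
            ∫ x, (f x - ∫ z, f z ∂(q.withDensity fun y => ENNReal.ofReal (w y))) ^ 2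
              ∂(q.withDensity fun y => ENNReal.ofReal (w y))) *
          (∑ s ∈ Finset.range N, (1 - (w x₀)⁻¹) ^ s) / N -
        (∫ x, ((∑ i ∈ Finset.range N, f (x i)) / N - ∫ z, f z ∂(q.withDensity fun y => ENNReal.ofReal (w y))) ^ 2
            ∂(Kernel.trajMeasure (X := fun _ : ℕ => Ω) (Measure.dirac x₀)
              (fun n : ℕ => (indepMH q w).comap (fun h : (i : ↥(Finset.Iic n)) → Ω => h ⟨n, Finset.mem_Iic.2 le_rfl⟩)
                (measurable_pi_apply _))) -
          ∫ x, ((∑ i ∈ Finset.range N, f (x i)) / N - ∫ z, f z ∂(q.withDensity fun y => ENNReal.ofReal (w y))) ^ 2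
            ∂(Kernel.trajMeasure (X := fun _ : ℕ => Ω) (q.withDensity fun y => ENNReal.ofReal (w y))
              (fun n : ℕ => (indepMH q w).comap (fun h : (i : ↥(Finset.Iic n)) → Ω => h ⟨n, Finset.mem_Iic.2 le_rfl⟩)
                (measurable_pi_apply _)))) := by
  have hw : Measurable w := Fact.out
  have hπK : Kernel.Invariant (indepMH q w) (q.withDensity fun y => ENNReal.ofReal (w y)) :=
    indepMH_invariant (q := q) hw hw0
  rw [imh_chain_sampleVariance_mode_eq hw0 hmax hf hC hN, chain_sampleVariance_stationary_eq (indepMH q w) hπK hf hC hN]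
  ring

/-- **TWO-SIDED**: `(δ² − V)S_N/N − (2w² − w)δ²/N² ≤ E_{x₀}[v̂_N] − E_π[v̂_N] ≤ (δ² − V)S_N/N + (2w² − w)V/N²`.
[ours] -/
theorem imh_chain_sampleVariance_mode_two_sided [Fact (Measurable w)] (hw0 : ∀ y, 0 < w y) {x₀ : Ω}
    (hmax : ∀ y, w y ≤ w x₀) [IsProbabilityMeasure (q.withDensity fun y => ENNReal.ofReal (w y))]
    {f : Ω → ℝ} (hf : Measurable f) {C : ℝ} (hC : ∀ x, |f x| ≤ C) {N : ℕ} (hN : N ≠ 0) :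
    ((f x₀ - ∫ z, f z ∂(q.withDensity fun y => ENNReal.ofReal (w y))) ^ 2 -
            ∫ x, (f x - ∫ z, f z ∂(q.withDensity fun y => ENNReal.ofReal (w y))) ^ 2
              ∂(q.withDensity fun y => ENNReal.ofReal (w y))) *
          (∑ s ∈ Finset.range N, (1 - (w x₀)⁻¹) ^ s) / N -
        (2 * w x₀ ^ 2 - w x₀) * (f x₀ - ∫ z, f z ∂(q.withDensity fun y => ENNReal.ofReal (w y))) ^ 2 /
          (N : ℝ) ^ 2 ≤
      ∫ x, (∑ i ∈ Finset.range N, (f (x i) - (∑ j ∈ Finset.range N, f (x j)) / N) ^ 2) / N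
        ∂(Kernel.trajMeasure (X := fun _ : ℕ => Ω) (Measure.dirac x₀)
          (fun n : ℕ => (indepMH q w).comap (fun h : (i : ↥(Finset.Iic n)) → Ω => h ⟨n, Finset.mem_Iic.2 le_rfl⟩)
            (measurable_pi_apply _))) -
      ∫ x, (∑ i ∈ Finset.range N, (f (x i) - (∑ j ∈ Finset.range N, f (x j)) / N) ^ 2) / N
        ∂(Kernel.trajMeasure (X := fun _ : ℕ => Ω) (q.withDensity fun y => ENNReal.ofReal (w y))
          (fun n : ℕ => (indepMH q w).comap (fun h : (i : ↥(Finset.Iic n)) → Ω => h ⟨n, Finset.mem_Iic.2 le_rfl⟩)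
            (measurable_pi_apply _))) ∧
    ∫ x, (∑ i ∈ Finset.range N, (f (x i) - (∑ j ∈ Finset.range N, f (x j)) / N) ^ 2) / N
        ∂(Kernel.trajMeasure (X := fun _ : ℕ => Ω) (Measure.dirac x₀)
          (fun n : ℕ => (indepMH q w).comap (fun h : (i : ↥(Finset.Iic n)) → Ω => h ⟨n, Finset.mem_Iic.2 le_rfl⟩)
            (measurable_pi_apply _))) -
      ∫ x, (∑ i ∈ Finset.range N, (f (x i) - (∑ j ∈ Finset.range N, f (x j)) / N) ^ 2) / N
        ∂(Kernel.trajMeasure (X := fun _ : ℕ => Ω) (q.withDensity fun y => ENNReal.ofReal (w y))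
          (fun n : ℕ => (indepMH q w).comap (fun h : (i : ↥(Finset.Iic n)) → Ω => h ⟨n, Finset.mem_Iic.2 le_rfl⟩)
            (measurable_pi_apply _))) ≤
      ((f x₀ - ∫ z, f z ∂(q.withDensity fun y => ENNReal.ofReal (w y))) ^ 2 -
            ∫ x, (f x - ∫ z, f z ∂(q.withDensity fun y => ENNReal.ofReal (w y))) ^ 2
              ∂(q.withDensity fun y => ENNReal.ofReal (w y))) *
          (∑ s ∈ Finset.range N, (1 - (w x₀)⁻¹) ^ s) / N +
        (2 * w x₀ ^ 2 - w x₀) *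
            (∫ x, (f x - ∫ z, f z ∂(q.withDensity fun y => ENNReal.ofReal (w y))) ^ 2
              ∂(q.withDensity fun y => ENNReal.ofReal (w y))) / (N : ℝ) ^ 2 := by
  rw [imh_chain_sampleVariance_mode_sub_stationary hw0 hmax hf hC hN]
  have hup := imh_chain_mse_mode_le_stationary_add (q := q) hw0 hmax hf hC hN (x₀ := x₀)
  have hlo := imh_chain_mse_mode_ge_stationary_sub (q := q) hw0 hmax hf hC hN (x₀ := x₀)
  constructor <;> linarith

end Summit.Ventures.LatticeQCDFlow.Exactness
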